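import Mathlib
import Summits.KontsevichZagierPeriods.Zeta5Search.ClusterValuation
import Summits.KontsevichZagierPeriods.Zeta5Search.DenomLaw.ThresholdModelCensusSums
import Summits.KontsevichZagierPeriods.Zeta5Search.DenomLaw.ThresholdModelCensusDict

/-!
# ζ(5) search — DENOM-LAW: the threshold model, PART III (bridge to the tree's `R_b`), part A: class offsets, levels, cells, ranges

Cell `pub-zeta5`, track DENOM-LAW (K1 typing order item (1), «ThresholdModel port»): denom-engine-d2 g13's kernel-checked scratch module
`denom-law/engine-d2/g13/lean/LevelCensusBridge.lean` PART III (THRESHOLD-X5) filed VERBATIM in three parts (≤ 400 lines each; docstrings added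
where the scratch file had none) by denom-prover-d1 g5.  Part A of 3 (= 10th file of the port).
HONEST FRAMING: systematic search; MODEL/structure side — elementary integer arithmetic identifying the tree's `netExp`/`classSet`/`classExp`/`CentreIn` with the level census; nothing about ζ(5); no γ; no irrationality claim; records in print UNMOVED.
The mathematical header of PART III is the second module docstring of part A (`ThresholdModelBridge.lean`).
-/

namespace Summit.KontsevichZagierPeriods.Zeta5Search.DenomLaw.ThresholdModel.Rho

/-! # PART III — THE BRIDGE TO THE TREE'S `R_b`: `ClusterValuation.netExp / classSet / classExp / CentreIn` ARE the level
census (denom-engine-d2 g13, scratch typing; NOT a tree filing)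

HONEST FRAMING: as Parts I–II — MODEL/structure side, elementary integer bookkeeping; no linear form, no p-adic digit, no
kernel value; nothing about ζ(5); no γ; no irrationality claim; records in print UNMOVED.

THE TREE'S OBJECTS (`Zeta5Search/ClusterValuation.lean` §1 — the vocabulary of Theorems A/A′/B/C there and of
`KummerOctaveOne`, `ClassDigitLaw*`, `RecordCellADigits*`, `A4Window*`): a cell is `b : ℕ → ℤ` (`b 0 = b₀`, `b (j+1) = b_j`);
the positions `q ∈ [0, b₀]` index the factors `(y+q)` of `R_b(y) = 2(y + b₀/2)·Π_q (y+q)^{1 − depth(q)}`;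
`blockCount b q = #{j < 7 : q ∈ [b_j, b₀ − b_j]}`, `netExp b q = 1 − blockCount b q + [2q = b₀]` (poles = negative values),
`classSet b p x = {q ≤ b₀ : q ≡ x (mod p)}`, `CentreIn b p x ⟺ p ∣ 2x − b₀`, and the CLASS EXPONENT
`E_x = classExp b p x = Σ_{q ∈ classSet} netExp b q + [b₀ odd ∧ CentreIn]`.
THE DICTIONARY: the integer `t(ℓ,u)` of Part II is the position `q = t(ℓ,u) − 1` (Part II's blocks `[b_j+1, b₀−b_j+1]` and
numerator `[1, b₀+1]` are the tree's `[b_j, b₀−b_j]` and `[0, b₀]` shifted by one); the residue `x` of the tree has the class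
offset `u = uOf p m b₀ x ∈ (−p, p]` (the `u ≡ R₀ (mod 2)` with `t(ℓ,u) ≡ x+1 (mod p)`), and conversely.

## What is proved here (kernel-checked), for every tree cell `b` whose `(ρ, R₀)` at `(m, p)` lie in the LEVEL BOX of Part II
(`LevelBox p (R0b p m b₀) (rhob p m b₀ b_•)`: `(m−1)p ≤ b₀ − 2b_j`, `b_j ≥ (m−1)p`, `0 ≤ b₀ − (3m−2)p < 3p`), `m ≥ 1`:
* `mem_block_iff_blockCov`, `blockCount_eq_nBlocks`, **`netExp_eq`**: at `q = t(ℓ,u) − 1 ∈ [0, b₀]`,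
      `blockCount b q = nBlocks(ℓ,u)`  and  `netExp b q = [d(ℓ,u) = 0] − ord(ℓ,u)`
  — Part II's `ord` IS the pole order of the tree's `R_b` at its lattice points (the merged even centre aside).
* **`sum_classSet_eq_sum_levels`** (re-indexing: for ANY summand, Σ over the tree's `classSet b p x` = Σ over the numerator
  levels `ℓ ∈ [−1, 3m−1]` of the class offset of `x`, along `ℓ ↦ t(ℓ,u) − 1` — the `Finset.sum_bij` whose halves are Part II's
  `tOf_inj` / `exists_level_of_dvd` / `tOf_mem_num_iff`), **`sum_classSet_netExp`**, **`centreIn_iff`**, **`b0_odd_iff`**, and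
  the MAIN IDENTITY **`classExp_eq` / `classExp_eq_uOf`** (`p` odd): for every residue `x`, with `u = uOf p m b₀ x`,
      `E_x = classExp b p x = δ_A(u) + [u ∈ {0, p}] − (4m + 8) = scoreA(u) − (4m + 8)`
  — S3a IN THE TREE'S WORDS: the class exponent of `ClusterValuation` is Part I's amended threshold score shifted by the
  symmetric count `4m+8`; the tree's centre conventions (merged even centre `[2q = b₀]` in `netExp`, odd centre
  `[b₀ odd ∧ p ∣ 2x − b₀]` in `classExp`) add up EXACTLY to the engine's centre unit `[u ∈ {0,p}]` in both parities
  (`centreZero_iff` gives the even half, `b0_odd_iff` + `centreIn_iff` the odd half) — so the tree follows the ENGINE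
  convention, not census2's (the «266 cells» unit of X4-4 is invisible in `classExp`).
* **`isDominant_iff_classExp_le`**: on a deep tree cell (`BCell`, Part I) a class is DOMINANT (Part I: argmin of the
  threshold score) iff its residue has MINIMAL class exponent `E_x` among all residues — the p-adic meaning of dominance
  (the deepest classes carry the leading digit in Theorems B/C) is now a theorem about the tree's own `classExp`;
  `classExp_min_le_of_deep`: on a deep cell some residue has `E_x ≤ 4 − (4m+8)` (Part I's explicit class `u*`).
* **`classPoleCount_eq`**, **`classPoleCount_of_dominant`**: the tree's POLE COUNT of a class (`#{q ∈ class : netExp < 0}`, the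
  case variable of Theorems A′/B/C: single pole vs `≥ 2` poles) is `#{ℓ ∈ [−1,3m−1] : ord(ℓ,u) > [d(ℓ,u) = 0]}`, and a DOMINANT
  class of a deep cell has EXACTLY `m + 1` poles — the pole-frame levels `m−1 … 2m−1`, of orders `6 − L, 6, …, 6, 6 − R ≥ 2`
  (`δ ≤ 4`) up to the merged centre (`DeepCell.pole_indic_of_dominant`); so on the D region the single-pole regime
  (Theorem A′ / `ZeroEvaluation`) never meets a dominant class and the hypothesis `2 ≤ classPoleCount` of Theorems B/C always holds.
* **`classExp_octShift`** (OCTAVE SHIFT LAW for `E_x`): for the shifted cell `σ_k b = (b₀ + 3kp; b_j + kp)` (octave `m+k ≥ 1`)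
  and the SAME residue `x`:  `classExp (σ_k b) p x = classExp b p x − 4k`  (`ρ, R₀, u` are `σ`-invariant; only `4m+8` moves).
Kernel examples: the (1,11) cell `(28; 10,9,9,8,7,7,7)` of Parts I/II as a tree cell — `classExp` at the residues of the
classes `u = 1` (x = 8) and `u = 11` (x = 3, the self-mirror class through the centre position 14) by `decide` on the
tree's definitions, against the formula.
Numerical companion: `denom-law/code/d2g13/bridge13.py` recomputes `blockCount/netExp/classSet/CentreIn/classExp` from the
tree's definitions (integer membership) and checks `netExp = [d=0] − ord` position by position, `classExp = scoreA(uOf) − (4m+8)`,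
dominance ⟺ minimal `E_x`, the pole counts and the octave shift law on g10's eight exhaustive deep blocks + F2 and on 20,000
random NON-deep level-box cells (`p` odd ≤ 41, not necessarily prime; `m ≤ 5`).
-/

section TreeBridge

open Summit.KontsevichZagierPeriods.Zeta5Search.ClusterValuation (blockCount netExp classSet classExp CentreIn classPoleCount)
open Summit.KontsevichZagierPeriods.Zeta5Search.BigPrime (block)

/-- the seven lower parameters `b₁,…,b₇` of a tree cell `b : ℕ → ℤ` (`b 0 = b₀`, `b (j+1) = b_j`) as a `Fin 7`-vector. -/
def lowerB (b : ℕ → ℤ) : Fin 7 → ℤ := fun j => b ((j : ℕ) + 1)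

/-- Unfolding `lowerB`. -/
theorem lowerB_apply (b : ℕ → ℤ) (j : Fin 7) : lowerB b j = b ((j : ℕ) + 1) := rfl

/-! ### The class offset of a residue -/

/-- the CLASS OFFSET of the residue `x`: the unique `u ∈ (−p, p]`, `u ≡ R₀ (mod 2)`, whose levels are the integers
`≡ x + 1 (mod p)` (positions `q ≡ x`): `u = p − ((2x − b₀ + 3pm − p) mod 2p)` (theory-d1's `s2_x`; the engine's `ut`). -/
def uOf (p m b0 x : ℤ) : ℤ := p - (2 * x - b0 + 3 * (p * m) - p) % (2 * p)

/-- the level of the integer `x + 1` in its class: `(2x − b₀ + 3pm − p) div 2p`. -/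
def lOf (p m b0 x : ℤ) : ℤ := (2 * x - b0 + 3 * (p * m) - p) / (2 * p)

section Offset
variable {p m b0 : ℤ}

/-- `uOf x` is a class in `(−p, p]` of the right parity and `t(lOf x, uOf x) = x + 1`. -/
theorem uOf_spec (hp : 1 ≤ p) (x : ℤ) :
    -p < uOf p m b0 x ∧ uOf p m b0 x ≤ p ∧ (uOf p m b0 x - R0b p m b0) % 2 = 0 ∧
      tOf p m b0 (lOf p m b0 x) (uOf p m b0 x) = x + 1 := by
  set w : ℤ := 2 * x - b0 + 3 * (p * m) - p with hw
  have h2p : (0 : ℤ) < 2 * p := by linarith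
  have hdiv := Int.mul_ediv_add_emod w (2 * p)
  have hs0 : 0 ≤ w % (2 * p) := Int.emod_nonneg _ (by linarith)
  have hs1 : w % (2 * p) < 2 * p := Int.emod_lt_of_pos _ h2p
  have hu : uOf p m b0 x = p - w % (2 * p) := rfl
  have hl : lOf p m b0 x = w / (2 * p) := rfl
  have hs : w % (2 * p) = w - 2 * p * (w / (2 * p)) := by linarith
  have hc : (uOf p m b0 x - R0b p m b0) % 2 = 0 := by
    have e : uOf p m b0 x - R0b p m b0 = 2 * (p * (w / (2 * p)) - x) := by rw [hu, hs, hw]; unfold R0b; ring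
    rw [e]; omega
  refine ⟨by rw [hu]; linarith, by rw [hu]; linarith, hc, ?_⟩
  have h2 := two_mul_tOf hc (lOf p m b0 x)
  have e : b0 + 2 + dpos p m (lOf p m b0 x) (uOf p m b0 x) = 2 * (x + 1) := by
    rw [hu, hl, hs, hw]; unfold dpos; ring
  omega

/-- `uOf x` is a class of the cell (Part I's `IsClass`). -/
theorem uOf_isClass (hp : 1 ≤ p) (x : ℤ) : IsClass p (R0b p m b0) (uOf p m b0 x) :=
  ⟨(uOf_spec hp x).1, (uOf_spec hp x).2.1, (uOf_spec hp x).2.2.1⟩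

/-- the levels of `uOf x` are the integers `≡ x + 1 (mod p)`. -/
theorem dvd_uOf (hp : 1 ≤ p) (x : ℤ) : p ∣ x + 1 - tOf p m b0 0 (uOf p m b0 x) := by
  obtain ⟨_, _, hc, ht⟩ := uOf_spec (m := m) (b0 := b0) hp x
  rw [tOf_eq_tOf_zero_add hc] at ht
  exact ⟨lOf p m b0 x, by linarith⟩

/-- … and `uOf x` is the ONLY class with that property. -/
theorem eq_uOf_of_dvd (hp : 1 ≤ p) {u : ℤ} (hc : (u - R0b p m b0) % 2 = 0) (hu1 : -p < u) (hu2 : u ≤ p) {x : ℤ}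
    (hx : p ∣ x + 1 - tOf p m b0 0 u) : u = uOf p m b0 x := by
  obtain ⟨h1, h2, hc', -⟩ := uOf_spec (m := m) (b0 := b0) hp x
  refine class_eq_of_dvd hp hc hc' hu1 hu2 h1 h2 ?_
  have := dvd_sub (dvd_uOf (m := m) (b0 := b0) hp x) hx
  have e : x + 1 - tOf p m b0 0 (uOf p m b0 x) - (x + 1 - tOf p m b0 0 u) =
      tOf p m b0 0 u - tOf p m b0 0 (uOf p m b0 x) := by ring
  rwa [e] at this

/-- every class has residues: for any `u` there is an `x : ℕ` with `t(·,u) ≡ x + 1 (mod p)`. -/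
theorem exists_residue (hp : 1 ≤ p) (u : ℤ) : ∃ x : ℕ, p ∣ (x : ℤ) + 1 - tOf p m b0 0 u := by
  set t0 := tOf p m b0 0 u with ht0
  have h0 : 0 ≤ (t0 - 1) % p := Int.emod_nonneg _ (by linarith)
  have hdm := Int.mul_ediv_add_emod (t0 - 1) p
  refine ⟨((t0 - 1) % p).toNat, ⟨-((t0 - 1) / p), ?_⟩⟩
  rw [Int.toNat_of_nonneg h0]
  linarith

end Offset

/-! ### A tree cell in the level box: positions, blocks, `netExp` -/

section Cell
variable {b : ℕ → ℤ} {p : ℕ} {m ℓ u : ℤ}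

/-- `b₀ ≥ 0` (indeed `b₀ ≥ (3m−2)p ≥ p`). -/
theorem lbox_b0_nonneg (h : LevelBox (p : ℤ) (R0b p m (b 0)) (rhob p m (b 0) (lowerB b))) (hm : 1 ≤ m) : 0 ≤ b 0 := by
  have h1 := h.R0_nonneg
  have h2 := h.one_le_p
  unfold R0b at h1
  have : 0 ≤ (3 * m - 2) * (p : ℤ) := mul_nonneg (by linarith) (by linarith)
  linarith

/-- `b_j ≥ 0` (indeed `b_j ≥ (m−1)p`: the lower point digit, `ρ_j ≤ R₀ + p`). -/
theorem lbox_lower_nonneg (h : LevelBox (p : ℤ) (R0b p m (b 0)) (rhob p m (b 0) (lowerB b))) (hm : 1 ≤ m) (j : Fin 7) :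
    0 ≤ b ((j : ℕ) + 1) := by
  have h1 := h.r_le j
  have h2 := h.one_le_p
  simp only [rhob, R0b, lowerB] at h1
  have : 0 ≤ (m - 1) * (p : ℤ) := mul_nonneg (by linarith) (by linarith)
  nlinarith

/-- membership in the tree's ℕ-interval `block n β = [β, n − β]`, as integer inequalities (ℕ-subtraction resolved). -/
theorem mem_block_iff_int (n β q : ℕ) : q ∈ block n β ↔ (β : ℤ) ≤ q ∧ (q : ℤ) + β ≤ n := by
  simp only [block, Finset.mem_Icc]; omega

/-- **block membership**: the position `q = t(ℓ,u) − 1` lies in the tree's block `j` iff Part II's `BlockCov`. -/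
theorem mem_block_iff_blockCov (h : LevelBox (p : ℤ) (R0b p m (b 0)) (rhob p m (b 0) (lowerB b))) (hm : 1 ≤ m)
    (hc : (u - R0b (p : ℤ) m (b 0)) % 2 = 0) {q : ℕ} (hq : (q : ℤ) + 1 = tOf p m (b 0) ℓ u) (j : Fin 7) :
    q ∈ block (b 0).toNat (b ((j : ℕ) + 1)).toNat ↔ BlockCov (p : ℤ) m (rhob p m (b 0) (lowerB b) j) ℓ u := by
  rw [← tOf_mem_block_iff hc j, mem_block_iff_int, Int.toNat_of_nonneg (lbox_b0_nonneg h hm),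
    Int.toNat_of_nonneg (lbox_lower_nonneg h hm j), ← hq, lowerB_apply]
  omega

/-- the tree's `blockCount` as a `Fin 7` indicator sum. -/
theorem blockCount_eq_sum_indic (b : ℕ → ℤ) (q : ℕ) :
    (blockCount b q : ℤ) = ∑ j : Fin 7, indic (q ∈ block (b 0).toNat (b ((j : ℕ) + 1)).toNat) := by
  unfold blockCount indic
  rw [Finset.card_filter]
  push_cast
  exact Finset.sum_range (fun j => if q ∈ block (b 0).toNat (b (j + 1)).toNat then (1 : ℤ) else 0)

/-- **`blockCount b q = nBlocks(ℓ,u)`** at `q = t(ℓ,u) − 1`. -/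
theorem blockCount_eq_nBlocks (h : LevelBox (p : ℤ) (R0b p m (b 0)) (rhob p m (b 0) (lowerB b))) (hm : 1 ≤ m)
    (hc : (u - R0b (p : ℤ) m (b 0)) % 2 = 0) {q : ℕ} (hq : (q : ℤ) + 1 = tOf p m (b 0) ℓ u) :
    (blockCount b q : ℤ) = nBlocks (p : ℤ) m (rhob p m (b 0) (lowerB b)) ℓ u := by
  rw [blockCount_eq_sum_indic]
  unfold nBlocks
  exact Finset.sum_congr rfl (fun j _ => indic_congr (mem_block_iff_blockCov h hm hc hq j))

/-- a position `q ≤ b₀` of the class is a numerator integer: `NumCov`. -/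
theorem numCov_of_pos (hc : (u - R0b (p : ℤ) m (b 0)) % 2 = 0) {q : ℕ} (hq : (q : ℤ) + 1 = tOf p m (b 0) ℓ u)
    (hqn : (q : ℤ) ≤ b 0) : NumCov (p : ℤ) m (R0b p m (b 0)) ℓ u :=
  (tOf_mem_num_iff hc).1 ⟨by rw [← hq]; omega, by rw [← hq]; omega⟩

/-- **`netExp b q = [d(ℓ,u) = 0] − ord(ℓ,u)`** at `q = t(ℓ,u) − 1 ≤ b₀`: Part II's `ord` is the pole order of the tree's
`R_b` at its lattice points, the merged even centre `[2q = b₀] = [d = 0]` aside. -/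
theorem netExp_eq (h : LevelBox (p : ℤ) (R0b p m (b 0)) (rhob p m (b 0) (lowerB b))) (hm : 1 ≤ m)
    (hc : (u - R0b (p : ℤ) m (b 0)) % 2 = 0) {q : ℕ} (hq : (q : ℤ) + 1 = tOf p m (b 0) ℓ u) (hqn : (q : ℤ) ≤ b 0) :
    netExp b q = indic (dpos (p : ℤ) m ℓ u = 0) - ord (p : ℤ) (R0b p m (b 0)) m (rhob p m (b 0) (lowerB b)) ℓ u := by
  have h2 := two_mul_tOf hc ℓ
  unfold netExp ord
  rw [blockCount_eq_nBlocks h hm hc hq, indic_pos (numCov_of_pos hc hq hqn)]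
  unfold indic
  by_cases hd : dpos (p : ℤ) m ℓ u = 0
  · rw [if_pos (show 2 * (q : ℤ) = b 0 by omega), if_pos hd]; ring
  · rw [if_neg (show ¬ 2 * (q : ℤ) = b 0 by omega), if_neg hd]; ring

end Cell

/-! ### Level-range lemmas used by the class sum -/

section Range
variable {p R0 m ρ ℓ u : ℤ} {r : Fin 7 → ℤ}

/-- a numerator level lies in `[−1, 3m−1]`. -/
theorem mem_levels_of_numCov (h : LevelBox p R0 r) (hm : 1 ≤ m) (hu1 : -p ≤ u) (hu2 : u ≤ p)
    (hN : NumCov p m R0 ℓ u) : ℓ ∈ levels m := by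
  unfold levels
  rw [Finset.mem_Ico]
  by_contra hℓ
  rcases (show ℓ ≤ -2 ∨ 3 * m ≤ ℓ by omega) with hℓ | hℓ
  · exact (cov_below h.one_le_p h.R0_lt (show R0 ≤ R0 + p by linarith [h.one_le_p]) hm hu1 hℓ).2 hN
  · exact (cov_above h.one_le_p h.R0_lt (show R0 ≤ R0 + p by linarith [h.one_le_p]) hm hu2 hℓ).2 hN

/-- blocks sit inside the numerator. -/
theorem numCov_of_blockCov (hp : 0 ≤ p) (hm : 1 ≤ m) (hρ : ρ ≤ R0 + p) (hB : BlockCov p m ρ ℓ u) :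
    NumCov p m R0 ℓ u := by
  unfold BlockCov at hB
  unfold NumCov
  have : 0 ≤ (m - 1) * p := mul_nonneg (by linarith) hp
  nlinarith

/-- off the numerator `ord = 0`. -/
theorem ord_eq_zero_of_not_numCov (h : LevelBox p R0 r) (hm : 1 ≤ m) (hN : ¬ NumCov p m R0 ℓ u) :
    ord p R0 m r ℓ u = 0 := by
  unfold ord nBlocks
  rw [indic_neg hN, Finset.sum_eq_zero (fun j _ => indic_neg (fun hB =>
    hN (numCov_of_blockCov (by linarith [h.one_le_p]) hm (h.r_le j) hB)))]
  ring

/-- the doubled position is injective in the level. -/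
theorem dpos_inj (hp : 1 ≤ p) {ℓ ℓ' : ℤ} (h : dpos p m ℓ u = dpos p m ℓ' u) : ℓ = ℓ' := by
  unfold dpos at h
  have h0 : p * (2 * ℓ - 2 * ℓ') = 0 := by linarith
  rcases mul_eq_zero.1 h0 with h1 | h1 <;> omega

/-- the merged EVEN centre, summed over the levels of a class: `Σ_ℓ [d(ℓ,u) = 0] = [(u = 0 ∧ m even) ∨ (u = p ∧ m odd)]`
(`centreZero_iff`; at most one level, and it lies in `[0, 3m−1]`). -/
theorem sum_indic_dpos_eq_zero (hp : 1 ≤ p) (hm : 1 ≤ m) (hu1 : -p < u) (hu2 : u ≤ p) :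
    (∑ ℓ ∈ levels m, indic (dpos p m ℓ u = 0)) = indic ((u = 0 ∧ m % 2 = 0) ∨ (u = p ∧ m % 2 = 1)) := by
  by_cases hz : ∃ ℓ, dpos p m ℓ u = 0
  · obtain ⟨ℓ₀, h0⟩ := hz
    rw [indic_pos ((centreZero_iff hp hu1 hu2).1 ⟨ℓ₀, h0⟩)]
    have hmem : ℓ₀ ∈ levels m := by
      unfold levels
      rw [Finset.mem_Ico]
      have h0' := h0
      unfold dpos at h0'
      set k := 2 * ℓ₀ - 3 * m + 2 with hk
      have hu : u = p * k := by linarith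
      have hk0 : 0 ≤ k := by
        by_contra hneg
        have hneg' : k ≤ -1 := by omega
        have : p * k ≤ -p := by nlinarith
        linarith
      have hk1 : k ≤ 1 := by
        by_contra hbig
        have hbig' : 2 ≤ k := by omega
        have : 2 * p ≤ p * k := by nlinarith
        linarith
      constructor <;> omega
    rw [← sum_ite_level (levels m) ℓ₀ 1 hmem]
    refine Finset.sum_congr rfl (fun ℓ _ => ?_)
    by_cases e : ℓ = ℓ₀
    · rw [if_pos e, indic_pos (by rw [e]; exact h0)]
    · rw [if_neg e, indic_neg (fun h1 => e (dpos_inj hp (h1.trans h0.symm)))]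
  · rw [indic_neg (fun hcz => hz ((centreZero_iff hp hu1 hu2).2 hcz))]
    exact Finset.sum_eq_zero (fun ℓ _ => indic_neg (fun h1 => hz ⟨ℓ, h1⟩))

end Range

/-! ### The class sum, the odd centre, and the MAIN IDENTITY `E_x = scoreA(u_x) − (4m+8)` -/

end TreeBridge

end Summit.KontsevichZagierPeriods.Zeta5Search.DenomLaw.ThresholdModel.Rho
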